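import Literature.NumberTheory.Sieve.SmoothEndgameMinor
import Literature.NumberTheory.Sieve.SmoothSaddleScaleCompare
import HarnessLib

/-!
# Minor arcs for the smooth-weighted sums over smooth numbers: saddle-size junk term

Topic `Literature/NumberTheory/Sieve`; a PROVED variant of `Endgame.norm_smoothWeightSum_le_of_minor`
(`SmoothEndgameMinor`, [Harper2016, Theorem 1 and §5]).  There, for `S_w(θ; X) = ∑_{n ∈ S(X, y)} w(n/X) e(nθ)`
(`w(v) = v²(1−v)²`, `x/2 ≤ X ≤ x`) on a minor arc `|θ − a/q| > R/x` (`q ≤ R`), Abel summation from the sharp sums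
`U_n(θ) = ∑_{m ∈ S(n,y)} e(mθ)` gives
`‖S_w(θ; X)‖ ≤ C (log x)³ y^{5/2(1−α)} R^{−1/2+3/2(1−α)} 𝓟 + 164 (1 + log x)² y² x^{9/10} + 64 x/R³ + 1`
(`α = α(x,y)`, `𝓟 = x^α ζ(α,y)/√φ₂(α,y)`), the term `64 x/R³` coming from the TRIVIAL bound `‖U_n‖ ≤ n` at the small
scales `n < x/R`.  In the polylog regime `y = (log x)^K` this junk is NOT negligible against the main size
`𝓟 ≈ Ψ(x, y) = x^{1−1/K+o(1)}` when `R` is a power of `log x` (as it must be on the major arcs).  Here the small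
scales are bounded instead by Rankin's bound at the master saddle point, `‖U_n‖ ≤ Ψ(n, y) ≤ n^α ζ(α, y) ≤ x^α ζ(α, y)`
[HildebrandTenenbaum1986, (2.1)], which turns the junk into `32 x^α ζ(α, y)/R² = 32 √φ₂(α,y) · 𝓟/R²`:

`norm_smoothWeightSum_le_of_minor_saddle`: in the same range and under the same hypotheses,
`‖S_w(θ; X)‖ ≤ C (log x)³ y^{5/2(1−α)} R^{−1/2+3/2(1−α)} 𝓟 + 164 (1 + log x)² y² x^{9/10} + 32 x^α ζ(α,y)/R² + 1`.

The proof is that of `norm_smoothWeightSum_le_of_minor` verbatim except for the small scales.  Not here: the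
transfer to profile sums and the ternary minor arcs (companion file `SmoothParityMinorArcsSaddle`).

## References

* A. J. Harper, Compositio Math. 152 (2016), Theorem 1 and §5 [Harper2016].
* A. Hildebrand, G. Tenenbaum, Trans. AMS 296 (1986), §2 (2.1) [HildebrandTenenbaum1986].
-/

noncomputable section

open Finset Real Complex
open scoped FourierTransform

namespace Literature.NumberTheory.Sieve

namespace Endgame

/-- `‖U_n(θ)‖ ≤ x^α ζ(α, y)` for `n ≤ x`, `α = α(x, y)` (`x > 1`, `y ≥ 2`): the trivial bound `Ψ(n, y)` and Rankin's
bound at the master saddle point, `Ψ(n, y) ≤ n^α ζ(α, y) ≤ x^α ζ(α, y)`. [cite: HildebrandTenenbaum1986, §2 (2.1)] -/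
theorem norm_sharpSum_le_saddle {x : ℝ} {y : ℕ} (hx : 1 < x) (hy : 2 ≤ y) {n : ℕ} (hnx : (n : ℝ) ≤ x) (θ : ℝ) :
    ‖sharpSum n y θ‖ ≤ x ^ saddlePoint x y * smoothZeta (saddlePoint x y) y := by
  have hα0 : 0 < saddlePoint x y := saddlePoint_pos hx hy
  have hU : ‖sharpSum n y θ‖ ≤ ((Nat.smoothNumbersUpTo n (y + 1)).card : ℝ) := by
    unfold sharpSum
    calc _ ≤ ∑ m ∈ Nat.smoothNumbersUpTo n (y + 1), ‖(𝐞 ((m : ℝ) * θ) : ℂ)‖ := norm_sum_le _ _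
      _ = _ := by simp
  have hR := card_smoothNumbersUpTo_floor_le_rankin (Nat.cast_nonneg n) hα0 y
  rw [Nat.floor_natCast] at hR
  exact hU.trans (hR.trans (mul_le_mul_of_nonneg_right
    (Real.rpow_le_rpow (Nat.cast_nonneg n) hnx hα0.le) (smoothZeta_pos hα0).le))

set_option maxHeartbeats 1600000 in
/-- **Minor arcs for the smooth-weighted sums, saddle-size junk term.** For `x ≥ x₀`, `(log x)^8 ≤ y`,
`log y ≤ ½ (log x)^{1/6}`, `y^{80} ≤ x`, `x/2 ≤ X ≤ x`, `1 ≤ R ≤ x^{1/10}` and `θ` with `|θ − a/q| > R/x` for all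
`1 ≤ q ≤ R`, `a ∈ ℤ`:
`‖S_w(θ; X)‖ ≤ C (log x)³ y^{5/2(1−α)} R^{−1/2+3/2(1−α)} 𝓟 + 164 (1 + log x)² y² x^{9/10} + 32 x^α ζ(α,y)/R² + 1`,
`𝓟 = x^α ζ(α,y)/√φ₂(α,y)`, `α = α(x,y)` — Abel summation from the sharp sums, `norm_sharpSum_le_of_minor` at the scales
`x/R ≤ n ≤ X` and `norm_sharpSum_le_saddle` (Rankin at the master saddle point) at the scales `n < x/R`.
[cite: Harper2016, Theorem 1 and §5] -/
theorem norm_smoothWeightSum_le_of_minor_saddle :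
    ∃ C x₀ : ℝ, 0 < C ∧ ∀ (x : ℝ) (y : ℕ), x₀ ≤ x → Real.log x ^ 8 ≤ y →
      Real.log y ≤ 1 / 2 * Real.log x ^ (1 / 6 : ℝ) → (y : ℝ) ^ 80 ≤ x → ∀ X : ℝ, x / 2 ≤ X → X ≤ x →
      ∀ (R : ℝ), 1 ≤ R → R ≤ x ^ (1 / 10 : ℝ) →
      ∀ θ : ℝ, (∀ q : ℕ, 1 ≤ q → (q : ℝ) ≤ R → ∀ a : ℤ, R / x < |θ - a / q|) →
        ‖smoothWeightSum X y θ‖ ≤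
          C * Real.log x ^ 3 * (y : ℝ) ^ (5 / 2 * (1 - saddlePoint x y)) *
            R ^ (-(1 / 2 : ℝ) + 3 / 2 * (1 - saddlePoint x y)) *
            (x ^ saddlePoint x y * (smoothZeta (saddlePoint x y) y / Real.sqrt (saddlePhi₂ (saddlePoint x y) y))) +
          164 * (1 + Real.log x) ^ 2 * (y : ℝ) ^ 2 * x ^ (9 / 10 : ℝ) +
          32 * (x ^ saddlePoint x y * smoothZeta (saddlePoint x y) y) / R ^ 2 + 1 := by
  classical
  obtain ⟨C, x₀, hC, hsharp⟩ := norm_sharpSum_le_of_minor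
  refine ⟨4 * C, max x₀ 4, by positivity, fun x y hx hy8 hylog hy80 X hXlo hXhi R hR1 hRx θ hminor => ?_⟩
  have hx₀ : x₀ ≤ x := le_trans (le_max_left _ _) hx
  have hx4 : 4 ≤ x := le_trans (le_max_right _ _) hx
  have hx0 : 0 < x := by linarith
  have hX1 : 1 ≤ X := by linarith
  have hX0 : 0 < X := by linarith
  have hR0 : 0 < R := by linarith
  set N : ℕ := ⌊X⌋₊ with hN
  have hNX : (N : ℝ) ≤ X := Nat.floor_le hX0.le
  have hXN : X < N + 1 := Nat.lt_floor_add_one X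
  -- the bound `A` for the sharp sums at the scales `x/R ≤ n ≤ x`
  set A : ℝ := C * Real.log x ^ 3 * (y : ℝ) ^ (5 / 2 * (1 - saddlePoint x y)) *
      R ^ (-(1 / 2 : ℝ) + 3 / 2 * (1 - saddlePoint x y)) *
      (x ^ saddlePoint x y * (smoothZeta (saddlePoint x y) y / Real.sqrt (saddlePhi₂ (saddlePoint x y) y))) +
    41 * (1 + Real.log x) ^ 2 * (y : ℝ) ^ 2 * x ^ (9 / 10 : ℝ) with hA
  have hAbound : ∀ n : ℕ, x / R ≤ n → (n : ℝ) ≤ x → ‖sharpSum n y θ‖ ≤ A :=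
    fun n hn1 hn2 => hsharp x y hx₀ hy8 hylog hy80 R hR1 hRx θ hminor n hn1 hn2
  have hlogx0 : 0 ≤ Real.log x := Real.log_nonneg (by linarith)
  -- `y ≥ 2` (from `(log x)^8 ≤ y`, `x ≥ 4`)
  have hy2 : 2 ≤ y := by
    have hl4 : (1 : ℝ) < Real.log x := by
      have h := Real.log_le_log (by norm_num) hx4
      have h4 : (1 : ℝ) < Real.log 4 := by
        rw [Real.lt_log_iff_exp_lt (by norm_num)]
        have := Real.exp_one_lt_d9; linarith
      linarith
    have : (1 : ℝ) < Real.log x ^ 8 := one_lt_pow₀ hl4 (by norm_num)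
    have h2 : (1 : ℝ) < y := lt_of_lt_of_le this hy8
    have h3 : 1 < y := by exact_mod_cast h2
    omega
  have hx1 : 1 < x := by linarith
  have hα0 : 0 < saddlePoint x y := saddlePoint_pos hx1 hy2
  have hP0 : 0 ≤ x ^ saddlePoint x y * (smoothZeta (saddlePoint x y) y / Real.sqrt (saddlePhi₂ (saddlePoint x y) y)) := by
    have := smoothZeta_pos (y := y) hα0; positivity
  have hA0 : 0 ≤ A := by rw [hA]; positivity
  -- the Rankin majorant of the small scales
  set P : ℝ := x ^ saddlePoint x y * smoothZeta (saddlePoint x y) y with hP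
  have hPn : 0 ≤ P := by have := smoothZeta_pos (y := y) hα0; positivity
  -- ### Abel
  have habel := norm_smoothWeightSum_le_abel X y θ
  rw [← hN] at habel
  -- endpoint term
  have hend : |wt ((N : ℝ) / X)| * ‖sharpSum N y θ‖ ≤ 1 := by
    have hv0 : 0 ≤ (N : ℝ) / X := by positivity
    have hv1 : (N : ℝ) / X ≤ 1 := by rw [div_le_one hX0]; exact hNX
    have hwt : wt ((N : ℝ) / X) ≤ 1 / X ^ 2 := by
      unfold wt
      have h1 : 1 - (N : ℝ) / X ≤ 1 / X := by
        have e : (1 : ℝ) - N / X = (X - N) / X := by field_simp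
        rw [e, div_le_div_iff_of_pos_right hX0]; linarith
      have h2 : 0 ≤ 1 - (N : ℝ) / X := by linarith
      have h3 : (1 - (N : ℝ) / X) ^ 2 ≤ (1 / X) ^ 2 := pow_le_pow_left₀ h2 h1 2
      have h4 : ((N : ℝ) / X) ^ 2 ≤ 1 := by nlinarith
      calc ((N : ℝ) / X) ^ 2 * (1 - (N : ℝ) / X) ^ 2 ≤ 1 * (1 / X) ^ 2 := mul_le_mul h4 h3 (by positivity) zero_le_one
        _ = 1 / X ^ 2 := by ring
    rw [abs_of_nonneg (wt_nonneg _)]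
    calc wt ((N : ℝ) / X) * ‖sharpSum N y θ‖ ≤ (1 / X ^ 2) * N :=
          mul_le_mul hwt (norm_sharpSum_le N y θ) (norm_nonneg _) (by positivity)
      _ ≤ (1 / X ^ 2) * X := mul_le_mul_of_nonneg_left hNX (by positivity)
      _ = 1 / X := by field_simp
      _ ≤ 1 := by rw [div_le_one hX0]; exact hX1
  -- variation of the weights
  have hΔ : ∀ n ∈ Ico 1 N, |wt (((n + 1 : ℕ) : ℝ) / X) - wt ((n : ℝ) / X)| ≤ 2 * ((n : ℝ) + 1) / X ^ 2 := by
    intro n hn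
    obtain ⟨hn1, hnN⟩ := Finset.mem_Ico.mp hn
    have hu1 : ((n + 1 : ℕ) : ℝ) / X ≤ 1 := by
      rw [div_le_one hX0]; exact le_trans (by exact_mod_cast hnN) hNX
    have hv0 : 0 ≤ (n : ℝ) / X := by positivity
    have hvu : (n : ℝ) / X ≤ ((n + 1 : ℕ) : ℝ) / X := by
      apply div_le_div_of_nonneg_right _ hX0.le; push_cast; linarith
    refine (abs_wt_sub_le hu1 hv0 hvu).trans (le_of_eq ?_)
    push_cast; field_simp; ring
  -- ### split the sum at `M = ⌈x/R⌉`
  set M : ℕ := ⌈x / R⌉₊ with hM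
  have hxR1 : 1 ≤ x / R := by
    rw [le_div_iff₀ (by linarith), one_mul]
    calc R ≤ x ^ (1 / 10 : ℝ) := hRx
      _ ≤ x ^ (1 : ℝ) := Real.rpow_le_rpow_of_exponent_le hx1.le (by norm_num)
      _ = x := Real.rpow_one x
  have hMle : (M : ℝ) ≤ 2 * (x / R) := by
    have := Nat.ceil_lt_add_one (by positivity : 0 ≤ x / R); rw [← hM] at this; linarith
  have hMlt : (M : ℝ) < x / R + 1 := by rw [hM]; exact Nat.ceil_lt_add_one (by positivity)
  have hMge : x / R ≤ M := Nat.le_ceil _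
  have hxRx : x / R ≤ x := div_le_self hx0.le hR1
  -- small scales: Rankin at the master saddle point
  have hsmall : ∑ n ∈ (Ico 1 N).filter (fun n => n < M),
      |wt (((n + 1 : ℕ) : ℝ) / X) - wt ((n : ℝ) / X)| * ‖sharpSum n y θ‖ ≤ 32 * P / R ^ 2 := by
    have hterm : ∀ n ∈ (Ico 1 N).filter (fun n => n < M),
        |wt (((n + 1 : ℕ) : ℝ) / X) - wt ((n : ℝ) / X)| * ‖sharpSum n y θ‖ ≤ 2 * (M : ℝ) / X ^ 2 * P := by
      intro n hn
      obtain ⟨hn, hnM⟩ := Finset.mem_filter.mp hn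
      have hnM' : (n : ℝ) + 1 ≤ M := by exact_mod_cast hnM
      have hnx : (n : ℝ) ≤ x := by linarith
      have h1 := hΔ n hn
      have h2 : ‖sharpSum n y θ‖ ≤ P := norm_sharpSum_le_saddle hx1 hy2 hnx θ
      calc _ ≤ (2 * ((n : ℝ) + 1) / X ^ 2) * P := mul_le_mul h1 h2 (norm_nonneg _) (by positivity)
        _ ≤ 2 * (M : ℝ) / X ^ 2 * P := by
            apply mul_le_mul_of_nonneg_right _ hPn
            apply div_le_div_of_nonneg_right _ (by positivity)
            linarith
    calc _ ≤ ∑ n ∈ (Ico 1 N).filter (fun n => n < M), 2 * (M : ℝ) / X ^ 2 * P := Finset.sum_le_sum hterm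
      _ = (((Ico 1 N).filter (fun n => n < M)).card : ℝ) * (2 * (M : ℝ) / X ^ 2 * P) := by
          rw [Finset.sum_const, nsmul_eq_mul]
      _ ≤ (M : ℝ) * (2 * (M : ℝ) / X ^ 2 * P) := by
          apply mul_le_mul_of_nonneg_right _ (by positivity)
          have : (Ico 1 N).filter (fun n => n < M) ⊆ Finset.range M := by
            intro n hn; exact Finset.mem_range.mpr (Finset.mem_filter.mp hn).2
          exact_mod_cast (Finset.card_le_card this).trans (Finset.card_range M).le
      _ = 2 * (M : ℝ) ^ 2 / X ^ 2 * P := by ring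
      _ ≤ 2 * (2 * (x / R)) ^ 2 / (x / 2) ^ 2 * P := by
          apply mul_le_mul_of_nonneg_right _ hPn
          apply div_le_div₀ (by positivity) _ (by positivity) (pow_le_pow_left₀ (by positivity) hXlo 2)
          exact mul_le_mul_of_nonneg_left (pow_le_pow_left₀ (Nat.cast_nonneg M) hMle 2) (by norm_num)
      _ = 32 * P / R ^ 2 := by field_simp; ring
  have hlarge : ∑ n ∈ (Ico 1 N).filter (fun n => ¬ n < M),
      |wt (((n + 1 : ℕ) : ℝ) / X) - wt ((n : ℝ) / X)| * ‖sharpSum n y θ‖ ≤ 4 * A := by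
    have hterm : ∀ n ∈ (Ico 1 N).filter (fun n => ¬ n < M),
        |wt (((n + 1 : ℕ) : ℝ) / X) - wt ((n : ℝ) / X)| * ‖sharpSum n y θ‖ ≤ (2 * ((n : ℝ) + 1) / X ^ 2) * A := by
      intro n hn
      obtain ⟨hn, hnM⟩ := Finset.mem_filter.mp hn
      push Not at hnM
      obtain ⟨hn1, hnN⟩ := Finset.mem_Ico.mp hn
      have hnlo : x / R ≤ n := le_trans hMge (by exact_mod_cast hnM)
      have hnhi : (n : ℝ) ≤ x := le_trans (le_trans (by exact_mod_cast hnN.le) hNX) hXhi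
      exact mul_le_mul (hΔ n hn) (hAbound n hnlo hnhi) (norm_nonneg _) (by positivity)
    calc _ ≤ ∑ n ∈ (Ico 1 N).filter (fun n => ¬ n < M), (2 * ((n : ℝ) + 1) / X ^ 2) * A := Finset.sum_le_sum hterm
      _ ≤ ∑ n ∈ Ico 1 N, (2 * ((n : ℝ) + 1) / X ^ 2) * A :=
          Finset.sum_le_sum_of_subset_of_nonneg (Finset.filter_subset _ _) fun n _ _ => by positivity
      _ = (2 * A / X ^ 2) * ∑ n ∈ Ico 1 N, ((n : ℝ) + 1) := by
          rw [Finset.mul_sum]; refine Finset.sum_congr rfl fun n _ => by ring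
      _ ≤ (2 * A / X ^ 2) * ((N : ℝ) * (N + 1)) := by
          apply mul_le_mul_of_nonneg_left _ (by positivity)
          calc ∑ n ∈ Ico 1 N, ((n : ℝ) + 1) ≤ ∑ n ∈ Ico 1 N, ((N : ℝ) + 1) := by
                refine Finset.sum_le_sum fun n hn => ?_
                have := (Finset.mem_Ico.mp hn).2
                have : (n : ℝ) + 1 ≤ N := by exact_mod_cast this
                linarith
            _ = ((N - 1 : ℕ) : ℝ) * ((N : ℝ) + 1) := by rw [Finset.sum_const, Nat.card_Ico, nsmul_eq_mul]
            _ ≤ (N : ℝ) * (N + 1) := by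
                apply mul_le_mul_of_nonneg_right _ (by positivity)
                exact_mod_cast Nat.sub_le N 1
      _ ≤ (2 * A / X ^ 2) * (X * (X + 1)) := by
          apply mul_le_mul_of_nonneg_left _ (by positivity)
          exact mul_le_mul hNX (by linarith) (by positivity) hX0.le
      _ = 2 * A * ((X + 1) / X) := by field_simp
      _ ≤ 2 * A * 2 := by
          apply mul_le_mul_of_nonneg_left _ (by positivity)
          rw [div_le_iff₀ hX0]; linarith
      _ = 4 * A := by ring
  -- ### assemble
  have hsplit := Finset.sum_filter_add_sum_filter_not (Ico 1 N) (fun n => n < M)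
    (fun n => |wt (((n + 1 : ℕ) : ℝ) / X) - wt ((n : ℝ) / X)| * ‖sharpSum n y θ‖)
  have htot : ∑ n ∈ Ico 1 N, |wt (((n + 1 : ℕ) : ℝ) / X) - wt ((n : ℝ) / X)| * ‖sharpSum n y θ‖ ≤
      32 * P / R ^ 2 + 4 * A := by
    rw [← hsplit]; exact add_le_add hsmall hlarge
  rw [hA] at htot
  linarith [habel, hend, htot]

end Endgame

end Literature.NumberTheory.Sieve

end
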